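import Literature.NumberTheory.EllipticCurves.ImaginaryPeriod
import Literature.NumberTheory.EllipticCurves.Pal2012.QuadraticTwistPeriodProofs
import Literature.NumberTheory.EllipticCurves.ComplexPeriodProofs
import Mathlib.FieldTheory.IsAlgClosed.Basic
import HarnessLib

/-!
# The IMAGINARY period of a quadratic twist: `|Ω⁻(E^{(d)})|·√d = |u|·|Ω⁻(E)|` (`d > 0`) and
# `|Ω⁻(E^{(d)})|·√|d|·c_∞(E) = |u|·Ω(E)` (`d < 0`) — Pal 2012 Thm. 3.2 read on the minus period (PROOFS ONLY)

Topic `Literature/NumberTheory/EllipticCurves`; THEOREMS ONLY (no definition, no named fact). The tree has V. Pal's theorem for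
the REAL period of a quadratic twist (`realPeriodRat_mul_sqrt_of_twist_of_pos`, `…_of_neg'`, files
`Pal2012/QuadraticTwistPeriodProofs`, `ImaginaryPeriod`): `Ω(E^{(d)})·√d = |u|·Ω(E)` (`d > 0`), `Ω(E^{(d)})·√|d| =
|u|·c_∞(E)·|Ω⁻(E)|` (`d < 0`), for any model `C • E^{(d)} = V` (`u = u(C)`). This file derives the companion statements for the
IMAGINARY period `|Ω⁻| = imaginaryPeriodRat` through the Legendre-type relation `Ω·|Ω⁻| = ∫_{E(ℂ)}|ω ∧ ω̄|`
(`realPeriodRat_mul_imaginaryPeriodRat`, Cremona §3.7) and the scaling of the complex period: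

* `complexPeriod_quadraticTwist` — over `ℂ`: `‖ω ∧ ω̄‖(W^{(d)}) = ‖d‖⁻¹·‖ω ∧ ω̄‖(W)` (the twist is the change of variables
  `u = d^{−1/2}` over `ℂ`; `complexPeriod_smul_holds`, Silverman AEC III.1 Table 3.1; `u` is pinned through `Δ(C • W) = u⁻¹²Δ(W)`);
* `complexPeriod_map_of_smul_eq_quadraticTwist` — over `ℚ`: for `C • E^{(d)} = V`,
  `‖ω ∧ ω̄‖(V_ℂ) = |u(C)|²·|d|⁻¹·‖ω ∧ ω̄‖(E_ℂ)`;
* ★ `imaginaryPeriodRat_mul_sqrt_of_twist_of_pos` — `d > 0`: `|Ω⁻(V)|·√d = |u(C)|·|Ω⁻(E)|`;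
* ★ `imaginaryPeriodRat_mul_sqrt_mul_numRealComponents_of_twist_of_neg` — `d < 0`: `|Ω⁻(V)|·√(−d)·c_∞(E) = |u(C)|·Ω(E)`.

Motivation: crux stmt-BirchSwinnertonDyer-20368 road (C) (memo `Cruxes/SplitBadTwoRankOneOfFacts/PERIOD-CANCELS-w8g24.md` §6, gap
T⁻⁻ (ii)): the odd classes read the minus period ratio `μ_V·|Ω⁻(V)| = Ω⁻_{f_V}` of the good curve `V = E^{(d)}`, which these
identities transport to the base curve.

References: V. Pal, Proc. AMS 140 (2012) Thm. 3.2 [Pal2012]; J. E. Cremona, *Algorithms for Modular Elliptic Curves* (1997) §3.7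
[CremonaAlgorithms1997]; J. H. Silverman, AEC (2009) III.1 Table 3.1, X.2 Prop. 2.4 [SilvermanAEC2009]; R. L. Miller, LMS J.
Comput. Math. 14 (2011) Lemma 2.4 [Miller2011LMS].
-/

noncomputable section

open scoped Classical

namespace WeierstrassCurve

/-! ### Over `ℂ`: the complex period of a quadratic twist -/

section Complex

/-- Base change commutes with the quadratic twist (universal formulas in the `bᵢ`); private copy of the tree's
`map_quadraticTwist`. [cite: SilvermanAEC2009, X.2 Prop. 2.4] -/
private theorem map_quadraticTwist_aux' {F L : Type*} [Field F] [Field L] (V : WeierstrassCurve F)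
    (f : F →+* L) (d : F) : (V.quadraticTwist d).map f = (V.map f).quadraticTwist (f d) := by
  ext
  · simp
  · simp [map_div₀, map_ofNat]
  · simp
  · simp [map_div₀, map_ofNat]
  · simp [map_div₀, map_ofNat]

/-- **Scaling of a change of variables is pinned by the discriminant**: if `C • W = W'` with `Δ(W') = k·Δ(W)`, `Δ(W) ≠ 0`,
then `‖u(C)‖¹² = ‖k‖⁻¹` (`Δ(C • W) = u⁻¹²·Δ(W)`), hence `‖u(C)‖² = (‖k‖⁻¹)^{1/6}` in the two cases used below
(`k = 1`: `‖u‖ = 1`; `k = e¹²`: `‖u‖ = ‖e‖⁻¹`). [cite: SilvermanAEC2009, III.1 Table 3.1] -/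
theorem norm_u_pow_twelve_of_smul_eq (W W' : WeierstrassCurve ℂ) (hΔ : W.Δ ≠ 0) {C : VariableChange ℂ}
    (hC : C • W = W') {k : ℂ} (hk : W'.Δ = k * W.Δ) : ‖(C.u : ℂ)‖ ^ 12 * ‖k‖ = 1 := by
  have h := congrArg WeierstrassCurve.Δ hC
  rw [variableChange_Δ, hk] at h
  -- `u⁻¹² Δ = k Δ`, `Δ ≠ 0`
  have h' : ((C.u⁻¹ : ℂˣ) : ℂ) ^ 12 = k := mul_right_cancel₀ hΔ h
  have hu : (C.u : ℂ) ≠ 0 := C.u.ne_zero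
  rw [Units.val_inv_eq_inv_val, inv_pow] at h'
  rw [← h', norm_inv, norm_pow, mul_inv_cancel₀ (pow_ne_zero _ (norm_ne_zero_iff.mpr hu))]

/-- **The complex period of a quadratic twist over `ℂ`**: `‖ω ∧ ω̄‖(W^{(d)}) = ‖d‖⁻¹ · ‖ω ∧ ω̄‖(W)` for an elliptic `W/ℂ` and
`d ≠ 0` — over `ℂ` the twist `W^{(d)}` is `W` up to the change of variables `u = e⁻¹`, `e² = d` (`exists_variableChange_quadraticTwist_one`,
`exists_variableChange_quadraticTwist_mul_sq`), and `complexPeriod (C • W) = ‖u‖²·complexPeriod W` (`complexPeriod_smul_holds`).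
[cite: SilvermanAEC2009, III.1 Table 3.1 and X.2 Prop. 2.4] [cite: CremonaAlgorithms1997, §3.7] -/
theorem complexPeriod_quadraticTwist (W : WeierstrassCurve ℂ) [W.IsElliptic] {d : ℂ} (hd : d ≠ 0) :
    (W.quadraticTwist d).complexPeriod = ‖d‖⁻¹ * W.complexPeriod := by
  have hΔ : W.Δ ≠ 0 := W.isUnit_Δ.ne_zero
  obtain ⟨e, he⟩ := IsAlgClosed.exists_eq_mul_self d
  have he0 : e ≠ 0 := by rintro rfl; exact hd (by rw [he, mul_zero])
  -- step 1: `C₁ • W = W^{(1)}`, `‖u₁‖ = 1`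
  obtain ⟨C₁, h₁⟩ := W.exists_variableChange_quadraticTwist_one
  have hΔ₁ : (W.quadraticTwist 1).Δ = 1 * W.Δ := by rw [quadraticTwist_Δ, one_pow]
  have hu₁ : ‖(C₁.u : ℂ)‖ ^ 12 * ‖(1 : ℂ)‖ = 1 := norm_u_pow_twelve_of_smul_eq W _ hΔ h₁ hΔ₁
  rw [norm_one, mul_one] at hu₁
  have hu₁' : ‖(C₁.u : ℂ)‖ = 1 := (pow_eq_one_iff_of_nonneg (norm_nonneg _) (by norm_num)).mp hu₁
  -- step 2: `C₂ • W^{(1)} = W^{(e²)} = W^{(d)}`, `‖u₂‖ = ‖e‖⁻¹`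
  obtain ⟨C₂, h₂⟩ := (W).exists_variableChange_quadraticTwist_mul_sq 1 e he0
  have hd' : (1 : ℂ) * e ^ 2 = d := by rw [one_mul, sq, ← he]
  rw [hd'] at h₂
  haveI : (W.quadraticTwist 1).IsElliptic := W.isElliptic_quadraticTwist one_ne_zero
  have hΔ1 : (W.quadraticTwist 1).Δ ≠ 0 := (W.quadraticTwist 1).isUnit_Δ.ne_zero
  have hΔ₂ : (W.quadraticTwist d).Δ = e ^ 12 * (W.quadraticTwist 1).Δ := by
    rw [quadraticTwist_Δ, quadraticTwist_Δ, one_pow, one_mul, ← hd', one_mul, ← pow_mul]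
  have hu₂ : ‖(C₂.u : ℂ)‖ ^ 12 * ‖e ^ 12‖ = 1 := norm_u_pow_twelve_of_smul_eq _ _ hΔ1 h₂ hΔ₂
  have hu₂' : ‖(C₂.u : ℂ)‖ = ‖e‖⁻¹ := by
    rw [norm_pow, ← mul_pow] at hu₂
    have h12 : ‖(C₂.u : ℂ)‖ * ‖e‖ = 1 :=
      (pow_eq_one_iff_of_nonneg (mul_nonneg (norm_nonneg _) (norm_nonneg _)) (by norm_num)).mp hu₂
    exact eq_inv_of_mul_eq_one_left h12
  -- assemble
  rw [← h₂, complexPeriod_smul_holds, ← h₁, complexPeriod_smul_holds, hu₁', hu₂', one_pow, one_mul, inv_pow,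
    ← norm_pow, sq, ← he]

/-- **The complex period of a model of a quadratic twist over `ℚ`**: for `C • E^{(d)} = V` (`d ≠ 0`),
`‖ω ∧ ω̄‖(V_ℂ) = |u(C)|² · |d|⁻¹ · ‖ω ∧ ω̄‖(E_ℂ)` (`V_ℂ = C_ℂ • (E_ℂ)^{(d)}`). [cite: SilvermanAEC2009, III.1 Table 3.1 and X.2 Prop. 2.4]
[cite: CremonaAlgorithms1997, §3.7] -/
theorem complexPeriod_map_of_smul_eq_quadraticTwist (E V : WeierstrassCurve ℚ) [E.IsElliptic] {d : ℚ} (hd : d ≠ 0)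
    {C : VariableChange ℚ} (hV : C • E.quadraticTwist d = V) :
    ((V.baseChange ℝ).map (algebraMap ℝ ℂ)).complexPeriod =
      |(C.u : ℚ)| ^ 2 * |d|⁻¹ * ((E.baseChange ℝ).map (algebraMap ℝ ℂ)).complexPeriod := by
  have hφ : (algebraMap ℝ ℂ).comp (algebraMap ℚ ℝ) = algebraMap ℚ ℂ := Subsingleton.elim _ _
  have hVC : (V.baseChange ℝ).map (algebraMap ℝ ℂ) = V.map (algebraMap ℚ ℂ) := by
    rw [baseChange, map_map, hφ]
  have hEC : (E.baseChange ℝ).map (algebraMap ℝ ℂ) = E.map (algebraMap ℚ ℂ) := by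
    rw [baseChange, map_map, hφ]
  haveI : (E.map (algebraMap ℚ ℂ)).IsElliptic := by
    change (E.baseChange ℂ).IsElliptic; infer_instance
  rw [hVC, hEC, ← hV, ← map_variableChange, complexPeriod_smul_holds, map_quadraticTwist_aux',
    complexPeriod_quadraticTwist _ ((map_ne_zero (algebraMap ℚ ℂ)).mpr hd)]
  have hu : (((C.map (algebraMap ℚ ℂ)).u : ℂˣ) : ℂ) = ((C.u : ℚ) : ℂ) := by
    simp [VariableChange.map]
  have hnu : ‖(((C.map (algebraMap ℚ ℂ)).u : ℂˣ) : ℂ)‖ = |((C.u : ℚ) : ℝ)| := by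
    rw [hu, Complex.norm_ratCast]
  have hnd : ‖(algebraMap ℚ ℂ) d‖ = |(d : ℝ)| := by
    rw [eq_ratCast, Complex.norm_ratCast]
  rw [hnu, hnd]
  push_cast
  ring

end Complex

/-! ### Over `ℚ`: the imaginary period of a twist -/

section Rat

variable (E : WeierstrassCurve ℚ) [E.IsElliptic]

/-- ★ **Pal's theorem for the IMAGINARY period, `d > 0`**: for any model `V` of the quadratic twist `E^{(d)}` (`C • E^{(d)} = V`,
`V` elliptic), `|Ω⁻(V)|·√d = |u(C)|·|Ω⁻(E)|` — from `Ω(V)·√d = |u|·Ω(E)` (Pal), the Legendre-type relations `Ω·|Ω⁻| = ‖ω ∧ ω̄‖`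
for `V` and `E`, and `‖ω ∧ ω̄‖(V_ℂ) = |u|²·d⁻¹·‖ω ∧ ω̄‖(E_ℂ)`. [cite: Pal2012, Thm. 3.2 (case d > 0)] [cite: CremonaAlgorithms1997, §3.7] -/
theorem imaginaryPeriodRat_mul_sqrt_of_twist_of_pos {d : ℚ} (hd : 0 < d) (V : WeierstrassCurve ℚ) [V.IsElliptic]
    (C : VariableChange ℚ) (hV : C • E.quadraticTwist d = V) :
    V.imaginaryPeriodRat * Real.sqrt (d : ℝ) = |((C.u : ℚ) : ℝ)| * E.imaginaryPeriodRat := by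
  haveI : (V.baseChange ℝ).IsElliptic := by rw [baseChange]; infer_instance
  haveI : (E.baseChange ℝ).IsElliptic := by rw [baseChange]; infer_instance
  have hdR : (0 : ℝ) < d := by exact_mod_cast hd
  have hsd : 0 < Real.sqrt (d : ℝ) := Real.sqrt_pos.mpr hdR
  have hsq : Real.sqrt (d : ℝ) ^ 2 = d := Real.sq_sqrt hdR.le
  have hΩV : 0 < V.realPeriodRat := by rw [realPeriodRat_def]; exact (V.baseChange ℝ).realPeriod_pos'
  have hΩE : 0 < E.realPeriodRat := by rw [realPeriodRat_def]; exact (E.baseChange ℝ).realPeriod_pos'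
  have hLV := V.realPeriodRat_mul_imaginaryPeriodRat
  have hLE := E.realPeriodRat_mul_imaginaryPeriodRat
  have hcp := complexPeriod_map_of_smul_eq_quadraticTwist E V hd.ne' hV
  have hPal := E.realPeriodRat_mul_sqrt_of_twist_of_pos hd V C hV
  have hdabs : |(d : ℝ)| = (d : ℝ) := abs_of_pos hdR
  -- `Ω(V)·|Ω⁻(V)| = |u|²/d · Ω(E)·|Ω⁻(E)|` and `Ω(V) = |u|Ω(E)/√d`
  have key : V.realPeriodRat * (V.imaginaryPeriodRat * Real.sqrt d) =
      V.realPeriodRat * (|((C.u : ℚ) : ℝ)| * E.imaginaryPeriodRat) := by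
    have h1 : V.realPeriodRat * V.imaginaryPeriodRat =
        |((C.u : ℚ) : ℝ)| ^ 2 * |(d : ℝ)|⁻¹ * (E.realPeriodRat * E.imaginaryPeriodRat) := by
      rw [hLV, hLE, hcp]; push_cast; ring
    rw [hdabs] at h1
    have h2 : V.realPeriodRat = |((C.u : ℚ) : ℝ)| * E.realPeriodRat / Real.sqrt d := by
      rw [eq_div_iff hsd.ne']; exact hPal
    have hs0 : Real.sqrt (d : ℝ) ≠ 0 := hsd.ne'
    calc V.realPeriodRat * (V.imaginaryPeriodRat * Real.sqrt d)
        = (V.realPeriodRat * V.imaginaryPeriodRat) * Real.sqrt d := by ring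
      _ = |((C.u : ℚ) : ℝ)| ^ 2 * (d : ℝ)⁻¹ * (E.realPeriodRat * E.imaginaryPeriodRat) * Real.sqrt d := by rw [h1]
      _ = |((C.u : ℚ) : ℝ)| ^ 2 * (E.realPeriodRat * E.imaginaryPeriodRat) *
            (Real.sqrt d * (Real.sqrt d * Real.sqrt d)⁻¹) := by rw [← sq, hsq]; ring
      _ = |((C.u : ℚ) : ℝ)| ^ 2 * (E.realPeriodRat * E.imaginaryPeriodRat) * (Real.sqrt d)⁻¹ := by
          rw [mul_inv]; field_simp
      _ = (|((C.u : ℚ) : ℝ)| * E.realPeriodRat / Real.sqrt d) * (|((C.u : ℚ) : ℝ)| * E.imaginaryPeriodRat) := by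
          rw [div_eq_mul_inv]; ring
      _ = V.realPeriodRat * (|((C.u : ℚ) : ℝ)| * E.imaginaryPeriodRat) := by rw [← h2]
  exact mul_left_cancel₀ hΩV.ne' key

/-- ★ **Pal's theorem for the IMAGINARY period, `d < 0`**: for any model `V` of the quadratic twist `E^{(d)}` (`C • E^{(d)} = V`,
`V` elliptic), `|Ω⁻(V)|·√(−d)·c_∞(E) = |u(C)|·Ω(E)` — from `Ω(V)·√(−d) = |u|·c_∞(E)·|Ω⁻(E)|` (Pal, `d < 0`), the Legendre-type
relations and `‖ω ∧ ω̄‖(V_ℂ) = |u|²·|d|⁻¹·‖ω ∧ ω̄‖(E_ℂ)`. [cite: Pal2012, Thm. 3.2 (case d < 0)] [cite: CremonaAlgorithms1997, §3.7]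
[cite: Miller2011LMS, Lemma 2.4] -/
theorem imaginaryPeriodRat_mul_sqrt_mul_numRealComponents_of_twist_of_neg {d : ℚ} (hd : d < 0) (V : WeierstrassCurve ℚ)
    [V.IsElliptic] (C : VariableChange ℚ) (hV : C • E.quadraticTwist d = V) :
    V.imaginaryPeriodRat * Real.sqrt (-(d : ℝ)) * (E.baseChange ℝ).numRealComponents =
      |((C.u : ℚ) : ℝ)| * E.realPeriodRat := by
  haveI : (V.baseChange ℝ).IsElliptic := by rw [baseChange]; infer_instance
  haveI : (E.baseChange ℝ).IsElliptic := by rw [baseChange]; infer_instance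
  have hdR : (d : ℝ) < 0 := by exact_mod_cast hd
  have hsd : 0 < Real.sqrt (-(d : ℝ)) := Real.sqrt_pos.mpr (neg_pos.mpr hdR)
  have hsq : Real.sqrt (-(d : ℝ)) ^ 2 = -(d : ℝ) := Real.sq_sqrt (neg_pos.mpr hdR).le
  have hΩV : 0 < V.realPeriodRat := by rw [realPeriodRat_def]; exact (V.baseChange ℝ).realPeriod_pos'
  have hΩmE : 0 < E.imaginaryPeriodRat := E.imaginaryPeriodRat_pos
  have hn : (0 : ℝ) < (E.baseChange ℝ).numRealComponents := by exact_mod_cast (E.baseChange ℝ).numRealComponents_pos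
  have hLV := V.realPeriodRat_mul_imaginaryPeriodRat
  have hLE := E.realPeriodRat_mul_imaginaryPeriodRat
  have hcp := complexPeriod_map_of_smul_eq_quadraticTwist E V hd.ne hV
  have hPal := E.realPeriodRat_mul_sqrt_of_twist_of_neg' hd V C hV
  have hdabs : |(d : ℝ)| = -(d : ℝ) := abs_of_neg hdR
  have key : V.realPeriodRat * (V.imaginaryPeriodRat * Real.sqrt (-(d : ℝ)) * (E.baseChange ℝ).numRealComponents) =
      V.realPeriodRat * (|((C.u : ℚ) : ℝ)| * E.realPeriodRat) := by
    have h1 : V.realPeriodRat * V.imaginaryPeriodRat =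
        |((C.u : ℚ) : ℝ)| ^ 2 * |(d : ℝ)|⁻¹ * (E.realPeriodRat * E.imaginaryPeriodRat) := by
      rw [hLV, hLE, hcp]; push_cast; ring
    rw [hdabs] at h1
    have h2 : V.realPeriodRat =
        |((C.u : ℚ) : ℝ)| * (E.baseChange ℝ).numRealComponents * E.imaginaryPeriodRat / Real.sqrt (-(d : ℝ)) := by
      rw [eq_div_iff hsd.ne']; exact hPal
    have hs0 : Real.sqrt (-(d : ℝ)) ≠ 0 := hsd.ne'
    calc V.realPeriodRat * (V.imaginaryPeriodRat * Real.sqrt (-(d : ℝ)) * (E.baseChange ℝ).numRealComponents)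
        = (V.realPeriodRat * V.imaginaryPeriodRat) * Real.sqrt (-(d : ℝ)) * (E.baseChange ℝ).numRealComponents := by ring
      _ = |((C.u : ℚ) : ℝ)| ^ 2 * (-(d : ℝ))⁻¹ * (E.realPeriodRat * E.imaginaryPeriodRat) * Real.sqrt (-(d : ℝ)) *
            (E.baseChange ℝ).numRealComponents := by rw [h1]
      _ = |((C.u : ℚ) : ℝ)| ^ 2 * (E.realPeriodRat * E.imaginaryPeriodRat) * (E.baseChange ℝ).numRealComponents *
            (Real.sqrt (-(d : ℝ)) * (Real.sqrt (-(d : ℝ)) * Real.sqrt (-(d : ℝ)))⁻¹) := by rw [← sq, hsq]; ring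
      _ = |((C.u : ℚ) : ℝ)| ^ 2 * (E.realPeriodRat * E.imaginaryPeriodRat) * (E.baseChange ℝ).numRealComponents *
            (Real.sqrt (-(d : ℝ)))⁻¹ := by
          rw [mul_inv]; field_simp
      _ = (|((C.u : ℚ) : ℝ)| * (E.baseChange ℝ).numRealComponents * E.imaginaryPeriodRat / Real.sqrt (-(d : ℝ))) *
            (|((C.u : ℚ) : ℝ)| * E.realPeriodRat) := by
          rw [div_eq_mul_inv]; ring
      _ = V.realPeriodRat * (|((C.u : ℚ) : ℝ)| * E.realPeriodRat) := by rw [← h2]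
  exact mul_left_cancel₀ hΩV.ne' key

end Rat

end WeierstrassCurve

end
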